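import Literature.Probability.Percolation.ArmSeparationSchemeFin
import Literature.Probability.Percolation.ZdFourArmFromFiveArm
import Literature.Probability.Percolation.FiniteEnergy
import HarnessLib

/-!
# The multi-scale scheme of Kesten's arm-separation theorem, instantiated for the four-arm event of bond percolation on `ℤ²`

Topic `Literature/Probability/Percolation`; critical bond percolation on `ℤ²`
(`bondPercolation (zdGraph 2) p`, any `p` here). PROOFS ONLY (no definition, no named fact).

The tree's bond-`ℤ²` four-arm programme is closed MODULO ONE DISPLAY, Kesten's arm-separation
theorem for four alternating arms (H. Kesten, CMP 109 (1987), §2, Lemmas 4–5; P. Nolin, EJP 13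
(2008), Thm. 11 [arXiv 0711.4948: Thm. 10] with §8.1; Duminil-Copin–Manolescu–Tassion, PTRF 181
(2021), Prop. 6.2 and 6.5, `q = 1`), in the form consumed by every user in the tree,

  `(S)  ∃ n₀ c, 0 < c ∧ ∀ n N, n₀ ≤ n → 2n ≤ N → c · P_{1/2}(fourArmTwoClusters n N) ≤ P_{1/2}(zdFourArmSep n N)`

(`zdFourArmSep`: `ZdFourArmSeparated.lean`): it is the hypothesis `hsep` of
`DuminilCopinManolescuTassion2021_zdFourArm_quasiMult_of_wellSeparated` and of
`Nolin2008_zdEdgeFourArmQuasiMult_of_zdFourArm_wellSeparated` (`ZdFourArmQuasiMultOfSeparation.lean`),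
of `zdFiveArm_pointBound_of_separation` (five-arm form, `ZdFiveArmPointBoundOfSeparation.lean`,
`ZdFiveArmQuasiMultOfSeparation.lean`), and the input of `Garban2011_fourArm_multiscale_of_separation`
(`FourArmGarbanSeparationReduction.lean`). Its site-`𝕋` twin IS a theorem of the tree
(`Nolin2008_twoArm_separation_holds`, `ArmSeparationFinalProofs.lean`; four arms:
`altSeparation_display`, `ArmSeparationNearCriticalFour.lean`), proved along Nolin's §4.4 on top of
the lattice-free summation `le_mul_of_separationScheme(_upto)` (`ArmSeparationScheme(Fin).lean`).

This file provides the two lattice-agnostic joints of that proof for the EXTERNAL half of `(S)`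
(Nolin 2008, §4.4, "1. External extremities", arXiv p. 12), so that the remaining work is exactly
the three percolation estimates named below:

* `real_le_add_mul_of_surgery` — **the step inequality from a deterministic surgery**, abstractly:
  if `E ⊆ E'`, `E ∖ B ⊆ G` ("off the bad event the arms can be made well-separated"), and `E'`, `B`
  are determined by disjoint sets of pairs, then `P(E) ≤ P(G) + P(B) · P(E')` (union bound and the
  product formula `bondPercolation_real_inter_of_disjoint`; Nolin: "by independence of the two
  latter events, `P(A(2^k,2^K)) ≤ P(Ã^{·/η'}(2^k,2^K)) + 4δ P(A(2^k,2^{K-1}))`");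
* `disjoint_annulusPairs_of_exists_notMem_box` — pairs of the annulus `A_{n,M}` versus a set of
  pairs each having an endpoint outside the box `B(M)` are disjoint (the support condition of the
  bad event: "what happens in `S_{2^{K-1},2^K}` is independent of what happens in `S_{2^{K-1}}`");
* `real_fourArmTwoClusters_le_add_mul` — **the step for the four-arm event**: for `n ≤ M ≤ N`, a
  bad event `B` read off pairs with an endpoint outside `B(M)` and any event `G` with
  `fourArmTwoClusters n N ∖ B ⊆ G`,
  `P(fourArmTwoClusters n N) ≤ P(G) + P(B) · P(fourArmTwoClusters n M)`
  (`determinedBy_fourArmTwoClusters`, `real_fourArmTwoClusters_mono`);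
* `real_fourArmTwoClusters_le_mul_of_scheme` — **the external multi-scale summation on the
  doubling ladder `R_K = n · 2^K`**: given event families `G K` ("the arms of `A₄(n, R_K)` can be
  made `δ`-separated on `∂B(R_K)`") and `H K` ("fenced arms landing on the fixed zones of
  `∂B(R_K)`", the outer half of `zdFourArmSep n R_K`) with
  (step) `P(A₄(n,R_{K+1})) ≤ P(G (K+1)) + ε P(A₄(n,R_K))`,
  (landing) `P(G K) ≤ C₁ P(H (K+1))`, (extension) `P(H K) ≤ C₀ P(H (K+1))`,
  (initial scale) `c ≤ P(H (k+1))`, and `ε C₀² ≤ 1/2`, conclude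
  `P(A₄(n, R_K)) ≤ (2C₁ + 1/c) · P(H K)` for `k+1 ≤ K ≤ L` — `le_mul_of_separationScheme_upto` with
  `f K = P(A₄(n, R_K))`, whose side conditions `f ≤ 1` and `f (K+1) ≤ f K` are discharged here;
  `real_fourArmTwoClusters_le_mul_of_scheme'` is the same along any ladder `n ≤ R K ≤ R (K+1)`;
* `disjoint_annulusPairs_of_exists_mem_box`, `real_fourArmTwoClusters_le_add_mul_inner`,
  `real_fourArmTwoClusters_le_mul_of_scheme_inner` — **the internal half read on the plain four-arm
  event** (Nolin 2008, §4.4, "2. Internal extremities"; Kesten 1987, Lemma 5): the inward step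
  `P(A₄(m,N)) ≤ P(G) + P(B) · P(A₄(m',N))` for `m ≤ m' ≤ N` and a bad event read off pairs reaching
  inside `B(m'-1)`, and the summation along a decreasing ladder of inner radii `m (K+1) ≤ m K ≤ N`.
  (Whichever half is run SECOND concerns fenced events and uses `real_le_add_mul_of_surgery` directly.)

## What remains for `(S)` (blueprint; sizes from the site-`𝕋` twins)

With `A₄ = fourArmTwoClusters`, `Sep = zdFourArmSep`, and two event families to be DEFINED (outer
fenced landing `OutLanded n N` = the outer half of `Sep`, fences OUTSIDE `B(N)` as in
`ZdSepOpenArmR`; and `OutGood_δ n N` = arms with `δ`-fences at pairwise `δ^{3/8}N`-separated tips,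
Nolin Def. 6–8, arXiv p. 9):
1. (step, the crux — Nolin Lemma 15 [arXiv 14] on the four side-rectangles of `A(M,2M)`; site twin
   `real_armEvent_le_outStepFr`, `ArmSeparationOutFrames.lean` and its ≈ 15 supporting files)
   `A₄(n,2M) ∖ Bad_δ(M) ⊆ OutGood_δ(n,2M)` with `Bad_δ(M)` determined by pairs having an endpoint
   outside `B(M)` and `P(Bad_δ(M)) ≤ ε(δ) → 0`; feed `real_fourArmTwoClusters_le_add_mul`. For
   ALTERNATING four arms single-colour lemmas suffice: rerouting an open arm onto the tip of the
   lowest canonical open crossing it meets keeps it in its own open cluster, so the two open arms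
   land on distinct (hence far apart, by protection) canonical tips; dually for the closed arms
   (tools: `BondStoppingSetDecoupling.lean`, `LowestCrossing.lean`, BK powers
   `measureReal_disjointOccurrencePow_le`, RSW `rsw_lowerBound_holds`, `AnnulusCircuitsProofs.lean`).
2. (landing) `P(OutGood_δ(n,M)) ≤ C₁(δ) P(OutLanded(n,2M))` and (extension)
   `P(OutLanded(n,M)) ≤ C₀ P(OutLanded(n,2M))` — Nolin Prop. 12 (i),(iii) [arXiv 11]: generalised FKG
   `bondPercolation_locallyMonotone_fkg`, RSW corridors as in `ZdFourArmSepGlue(Prob).lean`.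
3. (initial scale) `P(OutLanded(m,2m)) ≥ c` and `P(Sep(m,2m)) ≥ c`, `m ≥ n₀` (explicit corridors).
4. The INTERNAL half (Kesten Lemma 5; Nolin §4.4 "2. Internal extremities") is the same scheme read
   inwards on `f' i = P(OutLanded(n 2^i, N))`, with `real_le_add_mul_of_surgery` as the step joint,
   ending in `Sep`; then `(S)` on the ladder, and for general `N ≥ 2n` by `real_fourArmTwoClusters_mono`.

## References

* P. Nolin, *Near-critical percolation in two dimensions*, Electron. J. Probab. 13 (2008), §4.4,
  proof of Thm. 11 (arXiv 0711.4948: Thm. 10, pp. 11–13) [Nolin2008].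
* H. Kesten, *Scaling relations for 2D-percolation*, Comm. Math. Phys. 109 (1987), §2, Lemmas 4–5
  [KestenScalingCMP1987].
* O. Schramm, J. Steif, Ann. of Math. 171 (2010), Appendix A, Lemma A.4 [SchrammSteif2010].

Tree: `le_mul_of_separationScheme_upto` (`ArmSeparationSchemeFin.lean`);
`determinedBy_fourArmTwoClusters` (`ZdFourArmFromFiveArm.lean`); `real_fourArmTwoClusters_mono`
(`FourArmGarbanMonotone.lean`); `bondPercolation_real_inter_of_disjoint` (`FiniteEnergy.lean`);
`DeterminedBy.measurableSet_of_finset` (`PercolationEvents.lean`).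
-/

noncomputable section

namespace Literature.Probability.Percolation

open _root_.MeasureTheory _root_.Set LatticeModels

/-! ### The step inequality from a deterministic surgery -/

/-- **Step inequality from a surgery, abstract form** (Nolin 2008, §4.4: `A ⊆ Ã ∪ (Fail ∩ A')`
and "by independence of the two latter events"): if `E ⊆ E'`, `E ∖ B ⊆ G`, and `E'`, `B` are
determined by disjoint sets of pairs (`E'`, `B` measurable), then
`P(E) ≤ P(G) + P(B) · P(E')` for `P = bondPercolation Gr p`. [cite: Nolin2008, §4.4 (arXiv 0711.4948 p. 12, first two displays of "The arms are well-separated with positive probability")] -/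
theorem real_le_add_mul_of_surgery {V : Type*} [Countable V] (Gr : SimpleGraph V) (p : unitInterval)
    {E E' G B : Set (BondConfig V)} {S T : Set (Sym2 V)}
    (hEE' : E ⊆ E') (hsurg : E \ B ⊆ G) (hST : Disjoint S T)
    (hE' : DeterminedBy E' S) (hB : DeterminedBy B T) (hE'm : MeasurableSet E') (hBm : MeasurableSet B) :
    (bondPercolation Gr p).real E ≤
      (bondPercolation Gr p).real G + (bondPercolation Gr p).real B * (bondPercolation Gr p).real E' := by
  set μ := bondPercolation Gr p with hμ
  have hcover : E ⊆ G ∪ (B ∩ E') := by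
    intro ω hω
    by_cases hb : ω ∈ B
    · exact Or.inr ⟨hb, hEE' hω⟩
    · exact Or.inl (hsurg ⟨hω, hb⟩)
  have hprod : μ.real (B ∩ E') = μ.real B * μ.real E' := by
    rw [hμ]
    exact bondPercolation_real_inter_of_disjoint Gr p hST.symm hB hE' hBm hE'm
  calc μ.real E ≤ μ.real (G ∪ (B ∩ E')) := measureReal_mono hcover (measure_ne_top _ _)
    _ ≤ μ.real G + μ.real (B ∩ E') := measureReal_union_le _ _
    _ = μ.real G + μ.real B * μ.real E' := by rw [hprod]

/-! ### Supports: pairs of the annulus versus pairs reaching outside the box -/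

/-- **Pairs of the annulus `A_{n,M}` avoid every pair with an endpoint outside `B(M)`.** This is
the support condition making the bad event of the annulus `A(M, N)` independent of the four-arm
event `fourArmTwoClusters n M` (Nolin: "what happens in `S_{2^{K-1},2^K}` is independent of what
happens in `S_{2^{K-1}}`"). [cite: Nolin2008, §4.4 (arXiv 0711.4948 p. 12)] -/
theorem disjoint_annulusPairs_of_exists_notMem_box {n M : ℕ} {T : Set (Sym2 (Site 2))}
    (hT : ∀ e ∈ T, ∃ v ∈ e, v ∉ box 2 M) :
    Disjoint (↑((annulus 2 (n - 1) M).sym2) : Set (Sym2 (Site 2))) T := by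
  rw [Set.disjoint_left]
  intro e he heT
  obtain ⟨v, hv, hvM⟩ := hT e heT
  have hv' : v ∈ annulus 2 (n - 1) M := Finset.mem_sym2_iff.1 (Finset.mem_coe.1 he) v hv
  exact hvM (mem_annulus.1 hv').1

/-! ### The step for the four-arm event -/

/-- **The separation step for the four-arm event of bond percolation on `ℤ²`** (Nolin 2008, §4.4,
`P(A(2^k,2^K)) ≤ P(Ã^{·/η'}(2^k,2^K)) + 4δ · P(A(2^k,2^{K-1}))`, with the U-shaped-region lemma
abstracted into the inclusion `hsurg` and the failure event `B`): for `n ≤ M ≤ N`, if off the event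
`B` — determined by a set of pairs each having an endpoint outside `B(M)` — every configuration of
`fourArmTwoClusters n N` lies in `G`, then
`P(fourArmTwoClusters n N) ≤ P(G) + P(B) · P(fourArmTwoClusters n M)`. [cite: Nolin2008, §4.4, proof of Thm. 11, external extremities (arXiv 0711.4948: Thm. 10, p. 12)] [cite: KestenScalingCMP1987, §2 Lemma 4 (proof)] -/
theorem real_fourArmTwoClusters_le_add_mul (p : unitInterval) {n M N : ℕ} (hnM : n ≤ M) (hMN : M ≤ N)
    {G B : Set (BondConfig (Site 2))} {T : Finset (Sym2 (Site 2))}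
    (hsurg : fourArmTwoClusters n N \ B ⊆ G) (hB : DeterminedBy B ↑T)
    (hT : ∀ e ∈ T, ∃ v ∈ e, v ∉ box 2 M) :
    (bondPercolation (zdGraph 2) p).real (fourArmTwoClusters n N) ≤
      (bondPercolation (zdGraph 2) p).real G +
        (bondPercolation (zdGraph 2) p).real B * (bondPercolation (zdGraph 2) p).real (fourArmTwoClusters n M) := by
  have hae : ∀ᵐ ω ∂(bondPercolation (zdGraph 2) p), ω ⊆ (zdGraph 2).edgeSet :=
    ProbabilityTheory.setBernoulli_ae_subset
  -- replace the four-arm event of the long annulus by its lattice part, contained in the short one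
  set E : Set (BondConfig (Site 2)) := fourArmTwoClusters n N ∩ {ω | ω ⊆ (zdGraph 2).edgeSet} with hE
  have hEeq : (bondPercolation (zdGraph 2) p).real (fourArmTwoClusters n N) =
      (bondPercolation (zdGraph 2) p).real E := by
    refine le_antisymm ?_ (measureReal_mono Set.inter_subset_left (measure_ne_top _ _))
    refine ENNReal.toReal_mono (measure_ne_top _ _) (measure_mono_ae ?_)
    filter_upwards [hae] with ω hω h using ⟨h, hω⟩
  have hEE' : E ⊆ fourArmTwoClusters n M := by
    rintro ω ⟨h, hω⟩
    exact mem_fourArmTwoClusters_mono le_rfl hnM hMN hω h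
  have hsurg' : E \ B ⊆ G := fun ω hω => hsurg ⟨hω.1.1, hω.2⟩
  rw [hEeq]
  exact real_le_add_mul_of_surgery (zdGraph 2) p hEE' hsurg'
    (disjoint_annulusPairs_of_exists_notMem_box (n := n) (M := M) (T := ↑T) (fun e he => hT e (Finset.mem_coe.1 he)))
    (determinedBy_fourArmTwoClusters n M) hB
    (determinedBy_fourArmTwoClusters n M).measurableSet_of_finset hB.measurableSet_of_finset

/-! ### The external multi-scale summation on the doubling ladder -/

/-- **The external half of the arm-separation scheme for the four-arm event of `ℤ²`** (Nolin 2008,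
§4.4, "1. External extremities": the summation over the scales `R_K = n · 2^K` — step, landing
`C₁(η')C₂(η')`, extension `C₀`, "we may have taken `δ` such that `4δ C₀ < 1/2`" — concluding
`P(A_{j,σ}(2^k,2^K)) ≤ C₃(η') P(Ã̃^{·/η'₀,I_{η'₀}}(2^k,2^K))`): for event families `G K` (the arms of
`fourArmTwoClusters n (n 2^K)` can be made `δ`-separated on the outer boundary) and `H K` (fenced
arms landing on fixed zones of `∂B(n 2^K)`), the step, landing, extension and initial-scale
estimates with `ε C₀² ≤ 1/2` give `P(fourArmTwoClusters n (n 2^K)) ≤ (2C₁ + 1/c) · P(H K)` for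
`k + 1 ≤ K ≤ L`. This is `le_mul_of_separationScheme_upto` with `f K = P(fourArmTwoClusters n (n 2^K))`,
`g K = P(G K)`, `h K = P(H K)`; `f ≤ 1` and the monotonicity of `f` (a longer annulus is harder to
cross, `real_fourArmTwoClusters_mono`) are discharged here. [cite: Nolin2008, §4.4, proof of Thm. 11, external extremities (arXiv 0711.4948: Thm. 10, p. 12)] [cite: SchrammSteif2010, Appendix A, Lemma A.4] -/
theorem real_fourArmTwoClusters_le_mul_of_scheme (p : unitInterval) {n : ℕ}
    {G H : ℕ → Set (BondConfig (Site 2))} {k L : ℕ} {ε C₀ C₁ c : ℝ}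
    (hε : 0 ≤ ε) (hC₀ : 1 ≤ C₀) (hC₁ : 0 ≤ C₁) (hc : 0 < c) (hsmall : ε * C₀ ^ 2 ≤ 1 / 2) (hkL : k + 1 ≤ L)
    (hstep : ∀ K, k ≤ K → K + 1 ≤ L →
      (bondPercolation (zdGraph 2) p).real (fourArmTwoClusters n (n * 2 ^ (K + 1))) ≤
        (bondPercolation (zdGraph 2) p).real (G (K + 1)) +
          ε * (bondPercolation (zdGraph 2) p).real (fourArmTwoClusters n (n * 2 ^ K)))
    (hland : ∀ K, k + 1 ≤ K → K + 1 ≤ L →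
      (bondPercolation (zdGraph 2) p).real (G K) ≤ C₁ * (bondPercolation (zdGraph 2) p).real (H (K + 1)))
    (hext : ∀ K, k + 1 ≤ K → K + 1 ≤ L →
      (bondPercolation (zdGraph 2) p).real (H K) ≤ C₀ * (bondPercolation (zdGraph 2) p).real (H (K + 1)))
    (hinit : c ≤ (bondPercolation (zdGraph 2) p).real (H (k + 1))) :
    ∀ K, k + 1 ≤ K → K ≤ L →
      (bondPercolation (zdGraph 2) p).real (fourArmTwoClusters n (n * 2 ^ K)) ≤
        (2 * C₁ + 1 / c) * (bondPercolation (zdGraph 2) p).real (H K) := by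
  set μ := bondPercolation (zdGraph 2) p with hμ
  have hpow : ∀ K : ℕ, n ≤ n * 2 ^ K := fun K => Nat.le_mul_of_pos_right n (Nat.two_pow_pos K)
  have hpow' : ∀ K : ℕ, n * 2 ^ K ≤ n * 2 ^ (K + 1) := fun K =>
    Nat.mul_le_mul_left n (Nat.pow_le_pow_right (by norm_num) (Nat.le_succ K))
  refine le_mul_of_separationScheme_upto (f := fun K => μ.real (fourArmTwoClusters n (n * 2 ^ K)))
    (g := fun K => μ.real (G K)) (h := fun K => μ.real (H K)) hε hC₀ hC₁ hc hsmall
    (fun K => measureReal_le_one) (fun K => measureReal_nonneg) hkL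
    (fun K _ _ => real_fourArmTwoClusters_mono p le_rfl (hpow K) (hpow' K)) hstep hland hext hinit

/-- **The external summation along a general increasing ladder of outer radii** `R K`
(`n ≤ R K ≤ R (K+1)`; Nolin's `2^K`, the tree's `2n · 2^K`, or any other doubling-type ladder):
the same conclusion `P(fourArmTwoClusters n (R K)) ≤ (2C₁ + 1/c) · P(H K)` for `k + 1 ≤ K ≤ L`
from the step, landing, extension and initial-scale estimates. [cite: Nolin2008, §4.4, proof of Thm. 11, external extremities (arXiv 0711.4948: Thm. 10, p. 12)] -/
theorem real_fourArmTwoClusters_le_mul_of_scheme' (p : unitInterval) {n : ℕ} {R : ℕ → ℕ}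
    (hnR : ∀ K, n ≤ R K) (hR : ∀ K, R K ≤ R (K + 1))
    {G H : ℕ → Set (BondConfig (Site 2))} {k L : ℕ} {ε C₀ C₁ c : ℝ}
    (hε : 0 ≤ ε) (hC₀ : 1 ≤ C₀) (hC₁ : 0 ≤ C₁) (hc : 0 < c) (hsmall : ε * C₀ ^ 2 ≤ 1 / 2) (hkL : k + 1 ≤ L)
    (hstep : ∀ K, k ≤ K → K + 1 ≤ L →
      (bondPercolation (zdGraph 2) p).real (fourArmTwoClusters n (R (K + 1))) ≤
        (bondPercolation (zdGraph 2) p).real (G (K + 1)) +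
          ε * (bondPercolation (zdGraph 2) p).real (fourArmTwoClusters n (R K)))
    (hland : ∀ K, k + 1 ≤ K → K + 1 ≤ L →
      (bondPercolation (zdGraph 2) p).real (G K) ≤ C₁ * (bondPercolation (zdGraph 2) p).real (H (K + 1)))
    (hext : ∀ K, k + 1 ≤ K → K + 1 ≤ L →
      (bondPercolation (zdGraph 2) p).real (H K) ≤ C₀ * (bondPercolation (zdGraph 2) p).real (H (K + 1)))
    (hinit : c ≤ (bondPercolation (zdGraph 2) p).real (H (k + 1))) :
    ∀ K, k + 1 ≤ K → K ≤ L →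
      (bondPercolation (zdGraph 2) p).real (fourArmTwoClusters n (R K)) ≤
        (2 * C₁ + 1 / c) * (bondPercolation (zdGraph 2) p).real (H K) := by
  set μ := bondPercolation (zdGraph 2) p with hμ
  exact le_mul_of_separationScheme_upto (f := fun K => μ.real (fourArmTwoClusters n (R K)))
    (g := fun K => μ.real (G K)) (h := fun K => μ.real (H K)) hε hC₀ hC₁ hc hsmall
    (fun K => measureReal_le_one) (fun K => measureReal_nonneg) hkL
    (fun K _ _ => real_fourArmTwoClusters_mono p le_rfl (hnR K) (hR K)) hstep hland hext hinit

/-! ### The internal half: the step and the summation read inwards -/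

/-- **Pairs of the annulus `A_{m',N}` avoid every pair with an endpoint in the box `B(m'-1)`**
(the support condition of the internal step: a bad event of the inner annulus `A(m, m')` read off
pairs reaching strictly inside `B(m')` is independent of `fourArmTwoClusters m' N`). [cite: Nolin2008, §4.4, internal extremities (arXiv 0711.4948 p. 13)] -/
theorem disjoint_annulusPairs_of_exists_mem_box {m' N : ℕ} {T : Set (Sym2 (Site 2))}
    (hT : ∀ e ∈ T, ∃ v ∈ e, v ∈ box 2 (m' - 1)) :
    Disjoint (↑((annulus 2 (m' - 1) N).sym2) : Set (Sym2 (Site 2))) T := by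
  rw [Set.disjoint_left]
  intro e he heT
  obtain ⟨v, hv, hvm⟩ := hT e heT
  have hv' : v ∈ annulus 2 (m' - 1) N := Finset.mem_sym2_iff.1 (Finset.mem_coe.1 he) v hv
  exact (mem_annulus.1 hv').2 hvm

/-- **The internal separation step for the four-arm event of bond percolation on `ℤ²`** (Nolin
2008, §4.4, "2. Internal extremities": "the reasoning is the same … from `∂S_{2^k}` toward the
interior"): for `m ≤ m' ≤ N`, if off an event `B` determined by pairs each having an endpoint in
`B(m'-1)` every configuration of `fourArmTwoClusters m N` lies in `G`, then
`P(fourArmTwoClusters m N) ≤ P(G) + P(B) · P(fourArmTwoClusters m' N)`. [cite: Nolin2008, §4.4, proof of Thm. 11, internal extremities (arXiv 0711.4948: Thm. 10, p. 13)] [cite: KestenScalingCMP1987, §2 Lemma 5 (proof)] -/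
theorem real_fourArmTwoClusters_le_add_mul_inner (p : unitInterval) {m m' N : ℕ} (hmm' : m ≤ m') (hm'N : m' ≤ N)
    {G B : Set (BondConfig (Site 2))} {T : Finset (Sym2 (Site 2))}
    (hsurg : fourArmTwoClusters m N \ B ⊆ G) (hB : DeterminedBy B ↑T)
    (hT : ∀ e ∈ T, ∃ v ∈ e, v ∈ box 2 (m' - 1)) :
    (bondPercolation (zdGraph 2) p).real (fourArmTwoClusters m N) ≤
      (bondPercolation (zdGraph 2) p).real G +
        (bondPercolation (zdGraph 2) p).real B * (bondPercolation (zdGraph 2) p).real (fourArmTwoClusters m' N) := by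
  have hae : ∀ᵐ ω ∂(bondPercolation (zdGraph 2) p), ω ⊆ (zdGraph 2).edgeSet :=
    ProbabilityTheory.setBernoulli_ae_subset
  set E : Set (BondConfig (Site 2)) := fourArmTwoClusters m N ∩ {ω | ω ⊆ (zdGraph 2).edgeSet} with hE
  have hEeq : (bondPercolation (zdGraph 2) p).real (fourArmTwoClusters m N) =
      (bondPercolation (zdGraph 2) p).real E := by
    refine le_antisymm ?_ (measureReal_mono Set.inter_subset_left (measure_ne_top _ _))
    refine ENNReal.toReal_mono (measure_ne_top _ _) (measure_mono_ae ?_)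
    filter_upwards [hae] with ω hω h using ⟨h, hω⟩
  have hEE' : E ⊆ fourArmTwoClusters m' N := by
    rintro ω ⟨h, hω⟩
    exact mem_fourArmTwoClusters_mono hmm' hm'N le_rfl hω h
  have hsurg' : E \ B ⊆ G := fun ω hω => hsurg ⟨hω.1.1, hω.2⟩
  rw [hEeq]
  exact real_le_add_mul_of_surgery (zdGraph 2) p hEE' hsurg'
    (disjoint_annulusPairs_of_exists_mem_box (m' := m') (N := N) (T := ↑T) (fun e he => hT e (Finset.mem_coe.1 he)))
    (determinedBy_fourArmTwoClusters m' N) hB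
    (determinedBy_fourArmTwoClusters m' N).measurableSet_of_finset hB.measurableSet_of_finset

/-- **The internal summation along a decreasing ladder of inner radii** `m K`
(`m (K+1) ≤ m K ≤ N`, e.g. `m K = N / 2^K` or `n · 2^{L-K}`), outer radius `N` fixed (Nolin 2008,
§4.4, "2. Internal extremities", the displayed chain on arXiv p. 13, when the internal half is run
FIRST, i.e. on the plain four-arm event; run second it concerns the externally fenced events and
only `real_le_add_mul_of_surgery` applies): from the inward step
`P(A₄(m (K+1), N)) ≤ P(G (K+1)) + ε P(A₄(m K, N))`, the landing `P(G K) ≤ C₁ P(H (K+1))`, the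
inward extension `P(H K) ≤ C₀ P(H (K+1))`, the initial scale `c ≤ P(H (k+1))` and `ε C₀² ≤ 1/2`,
conclude `P(A₄(m K, N)) ≤ (2C₁ + 1/c) · P(H K)` for `k + 1 ≤ K ≤ L`. [cite: Nolin2008, §4.4, proof of Thm. 11, internal extremities (arXiv 0711.4948: Thm. 10, p. 13)] [cite: KestenScalingCMP1987, §2 Lemma 5] -/
theorem real_fourArmTwoClusters_le_mul_of_scheme_inner (p : unitInterval) {N : ℕ} {m : ℕ → ℕ}
    (hm : ∀ K, m (K + 1) ≤ m K) (hmN : ∀ K, m K ≤ N)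
    {G H : ℕ → Set (BondConfig (Site 2))} {k L : ℕ} {ε C₀ C₁ c : ℝ}
    (hε : 0 ≤ ε) (hC₀ : 1 ≤ C₀) (hC₁ : 0 ≤ C₁) (hc : 0 < c) (hsmall : ε * C₀ ^ 2 ≤ 1 / 2) (hkL : k + 1 ≤ L)
    (hstep : ∀ K, k ≤ K → K + 1 ≤ L →
      (bondPercolation (zdGraph 2) p).real (fourArmTwoClusters (m (K + 1)) N) ≤
        (bondPercolation (zdGraph 2) p).real (G (K + 1)) +
          ε * (bondPercolation (zdGraph 2) p).real (fourArmTwoClusters (m K) N))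
    (hland : ∀ K, k + 1 ≤ K → K + 1 ≤ L →
      (bondPercolation (zdGraph 2) p).real (G K) ≤ C₁ * (bondPercolation (zdGraph 2) p).real (H (K + 1)))
    (hext : ∀ K, k + 1 ≤ K → K + 1 ≤ L →
      (bondPercolation (zdGraph 2) p).real (H K) ≤ C₀ * (bondPercolation (zdGraph 2) p).real (H (K + 1)))
    (hinit : c ≤ (bondPercolation (zdGraph 2) p).real (H (k + 1))) :
    ∀ K, k + 1 ≤ K → K ≤ L →
      (bondPercolation (zdGraph 2) p).real (fourArmTwoClusters (m K) N) ≤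
        (2 * C₁ + 1 / c) * (bondPercolation (zdGraph 2) p).real (H K) := by
  set μ := bondPercolation (zdGraph 2) p with hμ
  exact le_mul_of_separationScheme_upto (f := fun K => μ.real (fourArmTwoClusters (m K) N))
    (g := fun K => μ.real (G K)) (h := fun K => μ.real (H K)) hε hC₀ hC₁ hc hsmall
    (fun K => measureReal_le_one) (fun K => measureReal_nonneg) hkL
    (fun K _ _ => real_fourArmTwoClusters_mono p (hm K) (hmN K) le_rfl) hstep hland hext hinit

end Literature.Probability.Percolation

end
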